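import Summits.AnomalousDissipation.AnomalousDissipation.Theorems.SolenoidalFractalHomogenisationLagrangianStepVmodFsRowsAssembly
import Summits.AnomalousDissipation.AnomalousDissipation.Theorems.SolenoidalFractalHomogenisationLagrangianStepVmodFsScalars
import Summits.AnomalousDissipation.AnomalousDissipation.Theorems.SolenoidalFractalHomogenisationLagrangianStepVmodFsIterRow
import Summits.AnomalousDissipation.AnomalousDissipation.Theorems.SolenoidalFractalHomogenisationLagrangianStepVmodFsMidRow
import Summits.AnomalousDissipation.AnomalousDissipation.Theorems.SolenoidalFractalHomogenisationLagrangianStepVmodFsHighAlwRow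
import Summits.AnomalousDissipation.AnomalousDissipation.Theorems.SolenoidalFractalHomogenisationLagrangianStepVmodSSSmall
import HarnessLib

/-!
# K1L_D (stmt-AnomalousDissipation-27980): (V_mod) flat stage, block (fs) — THE PER-LABEL ROW DISPATCH ON GRID-ANCHORED WINDOWS
# (constants bookkeeping of the (fs) block, part 1/2; prover ad-k1loc-p3 g11, `--supports 27980 --as helper`; part 2/2 = `…VmodFsGridAssembly`)

No new analysis: the dispatch of one grid-anchored instance of the (fs) per-label leak onto the landed rows (p3 g10's FINAL HANDOFF «WHAT IS LEFT»).
* §1 scalars: `mul_le_of_le_inv` (the shape `X·g ≤ δ` from `g ≤ δ/(X+1)`), `exists_small_scale` (a scale `0 < g₀ ≤ 1` meeting one `rpow`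
  and four linear smallness conditions — the six `g₀`-conditions of p1 g15's `VmodGen.coarse_smallness`), `coarse_RP_le_one` (`u = R·P ≤ 1`
  on coarse labels for EVERY `ν ≤ 1`, the first half of `coarse_smallness` without its `ν ≤ ν_c`), `two_norm_latticeVec_lt` (`2‖ℓ‖ < n` on
  `freqBall (n/4)`).
* §2 **`fs_row_of_grid`** — THE PER-LABEL ROW DISPATCH at a grid start `s = j·P`, `P = M·W.period/ν ≤ t − s`: for a nonzero slow label `ℓ`
  and a weakly divergence-free fast member `v` of its class pair, `‖𝓕(U s t v)(ℓ)‖ ≤ (C₁(C₁(ν^e + (⌈K/ν⌉₊/n)^e) + (min 1 (P/(t−s)))^e))·√dW·‖v‖`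
  for every `0 ≤ e ≤ min(σ/2, 1/2)`, by the five leaves  coarse ∧ Rτ ≤ 2 → `VmodGen.leak_le_alw_of_scale_mid_fast` (p719383) ·
  coarse ∧ Rτ ≥ 2 ∧ ν ≤ g₀ → `VmodGen.leak_le_alw_of_scale_iter_fast` (p719093; (V) consumed through `VmodGen.coarse_smallness`, p717612, with
  `ν_c := g₀`) · coarse ∧ Rτ ≥ 2 ∧ ν > g₀ → `leak_le_alw_of_floor_fast` (p720047, `dW ≥ 1/2`) · high ∧ ν < νh → `leak_le_alw_of_high_fast`
  (p719722; W7 consumed at `Kb = (K+1)/g₀` via `VmodGen.high_label_bounds`) · high ∧ ν ≥ νh → `leak_le_alw_of_floor_fast` (`dW ≥ ½·min 1 θL`,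
  `θL = 8π²(lo/Λ)(M·Wp)c·g₀²/(K+1)²`).  The thresholds on `C₁ ≥ 1` and the smallness of `g₀` are HYPOTHESES here (chosen in part 2/2).
`sorry`-free; NOT a proof of (fs), of `stub_Vmod_EHTthg`, of K1L_D or of AD; rung F-D1.A0.
-/

set_option linter.dupNamespace false

noncomputable section

namespace Summit.AnomalousDissipation.AnomalousDissipation.Theorems.SolenoidalFractalHomogenisation.LagrangianStep.VmodFlat

open Literature.Analysis Literature.Analysis.FluidPDE Literature.Analysis.FunctionSpaces
open MeasureTheory Set Filter UnitAddTorus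
open scoped ENNReal NNReal InnerProductSpace
open Summit.AnomalousDissipation.AnomalousDissipation.Theorems.SolenoidalFractalHomogenisation.LagrangianStep.CellClauseMod
open Summit.AnomalousDissipation.AnomalousDissipation.Theorems.SolenoidalFractalHomogenisation.LagrangianStep.LossCurrency
open Summit.AnomalousDissipation.AnomalousDissipation.Theorems.SolenoidalFractalHomogenisation.LagrangianStep.Sideband (slotAmp)

/-! ## §1 Scalars -/

/-- `X·g ≤ δ` as soon as `g ≤ δ/(X+1)` (`X, δ ≥ 0`). -/
theorem mul_le_of_le_inv {X g δ : ℝ} (hX : 0 ≤ X) (hδ : 0 ≤ δ) (h : g ≤ δ / (X + 1)) : X * g ≤ δ := by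
  have hX1 : 0 < X + 1 := by linarith
  calc X * g ≤ X * (δ / (X + 1)) := mul_le_mul_of_nonneg_left h hX
    _ = δ * (X / (X + 1)) := by ring
    _ ≤ δ * 1 := mul_le_mul_of_nonneg_left ((div_le_one hX1).2 (by linarith)) hδ
    _ = δ := mul_one δ

/-- **A small scale**: for `σ > 0`, nonnegative `X₁ … X₅` and positive `δ₁ … δ₅` there is `0 < g ≤ 1` with `X₁·g^σ ≤ δ₁` and `Xᵢ·g ≤ δᵢ`
(`i = 2 … 5`) — the shape of the six `g₀`-conditions of `VmodGen.coarse_smallness`. -/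
theorem exists_small_scale {σ X₁ X₂ X₃ X₄ X₅ δ₁ δ₂ δ₃ δ₄ δ₅ : ℝ} (hσ : 0 < σ)
    (hX₁ : 0 ≤ X₁) (hX₂ : 0 ≤ X₂) (hX₃ : 0 ≤ X₃) (hX₄ : 0 ≤ X₄) (hX₅ : 0 ≤ X₅)
    (hδ₁ : 0 < δ₁) (hδ₂ : 0 < δ₂) (hδ₃ : 0 < δ₃) (hδ₄ : 0 < δ₄) (hδ₅ : 0 < δ₅) :
    ∃ g : ℝ, 0 < g ∧ g ≤ 1 ∧ X₁ * g ^ σ ≤ δ₁ ∧ X₂ * g ≤ δ₂ ∧ X₃ * g ≤ δ₃ ∧ X₄ * g ≤ δ₄ ∧ X₅ * g ≤ δ₅ := by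
  set g₁ : ℝ := (δ₁ / (X₁ + 1)) ^ (1 / σ) with hg₁
  have hq₁ : 0 < δ₁ / (X₁ + 1) := div_pos hδ₁ (by linarith)
  have hg₁0 : 0 < g₁ := Real.rpow_pos_of_pos hq₁ _
  have hg₁σ : g₁ ^ σ = δ₁ / (X₁ + 1) := by
    rw [hg₁, ← Real.rpow_mul hq₁.le, one_div_mul_cancel hσ.ne', Real.rpow_one]
  set g : ℝ := min 1 (min g₁ (min (δ₂ / (X₂ + 1)) (min (δ₃ / (X₃ + 1)) (min (δ₄ / (X₄ + 1)) (δ₅ / (X₅ + 1)))))) with hg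
  have h2 : 0 < δ₂ / (X₂ + 1) := div_pos hδ₂ (by linarith)
  have h3 : 0 < δ₃ / (X₃ + 1) := div_pos hδ₃ (by linarith)
  have h4 : 0 < δ₄ / (X₄ + 1) := div_pos hδ₄ (by linarith)
  have h5 : 0 < δ₅ / (X₅ + 1) := div_pos hδ₅ (by linarith)
  have hg0 : 0 < g := by
    rw [hg]
    exact lt_min one_pos (lt_min hg₁0 (lt_min h2 (lt_min h3 (lt_min h4 h5))))
  have hgle1 : g ≤ 1 := min_le_left _ _
  have hgg₁ : g ≤ g₁ := (min_le_right _ _).trans (min_le_left _ _)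
  have hg2 : g ≤ δ₂ / (X₂ + 1) := (min_le_right _ _).trans ((min_le_right _ _).trans (min_le_left _ _))
  have hg3 : g ≤ δ₃ / (X₃ + 1) :=
    (min_le_right _ _).trans ((min_le_right _ _).trans ((min_le_right _ _).trans (min_le_left _ _)))
  have hg4 : g ≤ δ₄ / (X₄ + 1) :=
    (min_le_right _ _).trans ((min_le_right _ _).trans ((min_le_right _ _).trans ((min_le_right _ _).trans (min_le_left _ _))))
  have hg5 : g ≤ δ₅ / (X₅ + 1) :=
    (min_le_right _ _).trans ((min_le_right _ _).trans ((min_le_right _ _).trans ((min_le_right _ _).trans (min_le_right _ _))))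
  refine ⟨g, hg0, hgle1, ?_, mul_le_of_le_inv hX₂ hδ₂.le hg2, mul_le_of_le_inv hX₃ hδ₃.le hg3,
    mul_le_of_le_inv hX₄ hδ₄.le hg4, mul_le_of_le_inv hX₅ hδ₅.le hg5⟩
  have hgσ : g ^ σ ≤ δ₁ / (X₁ + 1) := by rw [← hg₁σ]; exact Real.rpow_le_rpow hg0.le hgg₁ hσ.le
  exact mul_le_of_le_inv hX₁ hδ₁.le hgσ

/-- **`u = R·P ≤ 1` on coarse labels, for every `ν ≤ 1`** (the first half of `VmodGen.coarse_smallness`, which carries the extra binder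
`ν ≤ ν_c` only for its second half): coarseness `‖ℓ‖⌈K/ν⌉ ≤ g₀·n` gives `|ℓ|²/(n²ν²) ≤ g₀²/K²`, whence
`8π²·loT·|ℓ|²·(M·Wp/ν) ≤ 8π²(lo/Λ)(M·Wp)(1+c)/K²·g₀² ≤ (that)·g₀ ≤ 1/(50(…+1)) ≤ 1`. -/
theorem coarse_RP_le_one {k : ℕ} (W : LatticeShear.LatticeWord k) {C c lo hi Λ M ν K g₀ : ℝ} {n : ℕ} {ℓ : Fin 3 → ℤ}
    (hC : 0 ≤ C) (hc : 0 ≤ c) (hlo : 0 < lo) (hhi : 0 ≤ hi) (hΛ : 1 ≤ Λ) (hM : 0 < M)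
    (hν : 0 < ν) (hν1 : ν ≤ 1) (hK : 0 < K) (hn : 1 ≤ n) (hg₀ : 0 < g₀) (hg₀1 : g₀ ≤ 1)
    (hcoarse : ‖Torus.latticeVec ℓ‖ * (⌈K / ν⌉₊ : ℝ) ≤ g₀ * n)
    (hA : 8 * Real.pi ^ 2 * (lo / Λ) * (M * W.period) * (1 + c) / K ^ 2 * g₀
      ≤ 1 / (50 * (2 * Real.sqrt 2 * C * (hi * Λ ^ 2 / lo) + 1))) :
    8 * Real.pi ^ 2 * loT lo Λ c ν n * Torus.freqNormSq ℓ * (M * W.period / ν) ≤ 1 := by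
  -- adapted from p1 g15's `VmodGen.coarse_smallness` (…VmodSSSmall), first half
  have hn0 : (0:ℝ) < n := by exact_mod_cast (show 0 < n from hn)
  have hΛ0 : 0 < Λ := lt_of_lt_of_le one_pos hΛ
  have hWp := Summit.AnomalousDissipation.AnomalousDissipation.Theorems.SolenoidalFractalHomogenisation.PermissibleCarrier.period_pos W
  have hMW : 0 < M * W.period := mul_pos hM hWp
  have hL0 : 0 ≤ ‖Torus.latticeVec ℓ‖ := norm_nonneg _
  set L : ℝ := ‖Torus.latticeVec ℓ‖ with hL
  set q : ℝ := Torus.freqNormSq ℓ with hq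
  have hqL : q = L ^ 2 := by rw [hq, hL, Torus.norm_latticeVec_sq]
  have hq0 : 0 ≤ q := by rw [hq]; exact Torus.freqNormSq_nonneg ℓ
  set r₀ : ℝ := hi * Λ ^ 2 / lo with hr₀
  have hr₀0 : 0 ≤ r₀ := by rw [hr₀]; positivity
  have hceil : K / ν ≤ (⌈K / ν⌉₊ : ℝ) := Nat.le_ceil _
  have hLnν : L / (n * ν) ≤ g₀ / K := by
    have h1 : L * (K / ν) ≤ g₀ * n := (mul_le_mul_of_nonneg_left hceil hL0).trans hcoarse
    rw [div_le_div_iff₀ (by positivity) hK]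
    have := mul_le_mul_of_nonneg_right h1 hν.le
    calc L * K = L * (K / ν) * ν := by field_simp
      _ ≤ g₀ * n * ν := this
      _ = g₀ * (n * ν) := by ring
  have hLnν0 : 0 ≤ L / (n * ν) := by positivity
  have hqn : q / ((n:ℝ) ^ 2 * ν ^ 2) ≤ g₀ ^ 2 / K ^ 2 := by
    have := pow_le_pow_left₀ hLnν0 hLnν 2
    rw [div_pow, div_pow, mul_pow] at this
    rwa [hqL]
  set u : ℝ := 8 * Real.pi ^ 2 * loT lo Λ c ν n * q * (M * W.period / ν) with hu
  have hu_eq : u = 8 * Real.pi ^ 2 * (lo / Λ) * (M * W.period) * ((ν ^ 2 + c) * (q / ((n:ℝ) ^ 2 * ν ^ 2))) := by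
    rw [hu]; unfold loT; field_simp
  have hu_le : u ≤ 8 * Real.pi ^ 2 * (lo / Λ) * (M * W.period) * (1 + c) / K ^ 2 * g₀ ^ 2 := by
    rw [hu_eq]
    have h1 : (ν ^ 2 + c) * (q / ((n:ℝ) ^ 2 * ν ^ 2)) ≤ (1 + c) * (g₀ ^ 2 / K ^ 2) :=
      mul_le_mul (by nlinarith) hqn (by positivity) (by positivity)
    have := mul_le_mul_of_nonneg_left h1 (by positivity : 0 ≤ 8 * Real.pi ^ 2 * (lo / Λ) * (M * W.period))
    refine this.trans (le_of_eq ?_); ring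
  have hδ : u ≤ 1 / (50 * (2 * Real.sqrt 2 * C * r₀ + 1)) := by
    refine hu_le.trans (le_trans ?_ hA)
    have h0 : 0 ≤ 8 * Real.pi ^ 2 * (lo / Λ) * (M * W.period) * (1 + c) / K ^ 2 := by positivity
    have : g₀ ^ 2 ≤ g₀ := by nlinarith
    exact mul_le_mul_of_nonneg_left this h0
  exact hδ.trans (by
    rw [div_le_one (by positivity)]; nlinarith [mul_nonneg (mul_nonneg (by positivity : (0:ℝ) ≤ 2 * Real.sqrt 2) hC) hr₀0])

/-- `2‖ℓ‖ < n` for `ℓ ∈ freqBall (n/4)`, `1 ≤ n`. -/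
theorem two_norm_latticeVec_lt {n : ℕ} (hn : 1 ≤ n) {ℓ : Fin 3 → ℤ} (hℓ : ℓ ∈ Torus.freqBall (d := Fin 3) (n / 4)) :
    2 * ‖Torus.latticeVec ℓ‖ < n := by
  have hn0 : (0:ℝ) < n := by exact_mod_cast (show 0 < n from hn)
  have hq : ‖Torus.latticeVec ℓ‖ ^ 2 ≤ (((n / 4 : ℕ) : ℝ)) ^ 2 := by
    rw [Torus.norm_latticeVec_sq]; exact Torus.mem_freqBall.1 hℓ
  have hL : ‖Torus.latticeVec ℓ‖ ≤ ((n / 4 : ℕ) : ℝ) := by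
    have h := Real.sqrt_le_sqrt hq
    rwa [Real.sqrt_sq (norm_nonneg _), Real.sqrt_sq (Nat.cast_nonneg _)] at h
  have h4 : ((n / 4 : ℕ) : ℝ) ≤ (n : ℝ) / 4 := Nat.cast_div_le
  linarith

/-! ## §2 The per-label row dispatch at a grid start -/

set_option maxHeartbeats 4000000 in
/-- **THE (fs) ROW DISPATCH AT A GRID START** (five leaves; constants as hypotheses).  See the module docstring. -/
theorem fs_row_of_grid {k : ℕ} (W : LatticeShear.LatticeWord k) (M : ℝ) (hM : 0 < M) {c : ℝ} (hc : 0 < c)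
    (Φ : ℝ → Torus.Visc4 (Fin 3) → Torus.Visc4 (Fin 3)) {lo hi Λ β σ C ν₀ K : ℝ}
    (hlo : 0 < lo) (hhi : 1 ≤ hi) (hΛ : 1 < Λ) (hσ : 0 < σ) (hC : 0 ≤ C) (hν₀ : ν₀ ≤ 1) (hK : 0 < K)
    (hV : SlowVectorClauseF W M hM c Φ lo hi Λ β σ C ν₀ K)
    {g₀ : ℝ} (hg₀ : 0 < g₀) (hg₀1 : g₀ ≤ 1)
    (hgσ : 2 * Real.sqrt 2 * C ^ 2 * g₀ ^ σ ≤ 1 / 50)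
    (hA : 8 * Real.pi ^ 2 * (lo / Λ) * (M * W.period) * (1 + c) / K ^ 2 * g₀
      ≤ 1 / (50 * (2 * Real.sqrt 2 * C * (hi * Λ ^ 2 / lo) + 1)))
    (hB : 12 * k * Real.exp (9 * (k : ℝ) ^ 2 / (2 * Real.pi ^ 4 * (lo / Λ) ^ 2 * c)) / (Real.pi ^ 2 * (lo / Λ) * K) * g₀ ≤ 1 / 50)
    (hBs : 24 * (∑ j, ‖slotAmp W j‖) / (Real.pi * (lo / Λ) * K) * g₀ ≤ 1 / 50)
    (hgd : 16 * (1 + c) * g₀ / K ^ 2 ≤ 1 / 50)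
    {νh CK cK : ℝ} (hH : HighLabelDecayW W M hM lo hi Λ β νh ((K + 1) / g₀) CK cK) (hCK : 1 ≤ CK) (hcK : 0 < cK) (hνh : 0 < νh)
    {ν : ℝ} (hν : ν ∈ Set.Ioo 0 ν₀) {n : ℕ} (hn : (⌈K / ν⌉₊ : ℝ) ≤ n) {𝔸 : Torus.Visc4 (Fin 3)}
    (hodd : Torus.OddSmall 𝔸 (ν * β)) (hwin : ∃ lam ∈ Set.Icc (1:ℝ) Λ, Torus.NearIso 𝔸 (ν * (lo / lam)) (ν * (hi * lam)))
    (hΦw : ∃ lam ∈ Set.Icc (1:ℝ) Λ, Torus.NearIso (Φ ν ((1 / ν) • 𝔸)) (lo / lam) (hi * lam))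
    {Tw : ℝ} {U T : ℝ → ℝ → (V2 →L[ℝ] V2)}
    (hU : Torus.IsPropagator Tw (cellField W M hM ν hν.1 n) ((1 / (n:ℝ) ^ 2) • 𝔸) U)
    (hT : Torus.IsPropagator Tw (fun _ _ => 0) ((1 / (n:ℝ) ^ 2) • (𝔸 + (c / ν) • Φ ν ((1 / ν) • 𝔸))) T)
    {s t : ℝ} (j : ℕ) (hsj : s = j * (M * W.period / ν)) (hst : s < t) (htT : t ≤ Tw) (hτP : M * W.period / ν ≤ t - s)
    {C₁ e : ℝ} (he0 : 0 ≤ e) (heσ : e ≤ σ / 2) (he12 : e ≤ 1 / 2) (hC₁1 : 1 ≤ C₁)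
    (hC₁a : 2 * 265 * (2 * Real.sqrt 2) * C ^ 2 ≤ C₁)
    (hC₁b : 4 * 265 * (2 * Real.sqrt 2 * C ^ 2 * ((K + 1) ^ 2 / (8 * Real.pi ^ 2 * (lo / Λ) * (M * W.period) * c)) ^ (σ / 2)
        + 2 * Real.sqrt 2 * C * (hi * Λ ^ 2 / lo)
        + 12 * k * Real.exp (9 * (k : ℝ) ^ 2 / (2 * Real.pi ^ 4 * (lo / Λ) ^ 2 * c))
            / (Real.pi ^ 2 * (lo / Λ) * Real.sqrt (8 * Real.pi ^ 2 * (lo / Λ) * (M * W.period) * c))) ≤ C₁)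
    (hC₁f : 1 / (g₀ ^ e * Real.sqrt (1 / 2)) ≤ C₁)
    (hC₁h : Real.sqrt CK * Real.exp (cK * (M * W.period))
        / (cK * (M * W.period) * Real.sqrt ((1 / 2) * min 1 (8 * Real.pi ^ 2 * (lo / Λ) * (M * W.period) * c * g₀ ^ 2 / (K + 1) ^ 2))) ≤ C₁)
    (hC₁g : 1 / (νh ^ e * Real.sqrt ((1 / 2) * min 1 (8 * Real.pi ^ 2 * (lo / Λ) * (M * W.period) * c * g₀ ^ 2 / (K + 1) ^ 2))) ≤ C₁)
    {ℓ : Fin 3 → ℤ} (hℓ : ℓ ∈ (Torus.freqBall (d := Fin 3) (n / 4)).erase 0)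
    (v : V2) (hv : v ∈ Torus.divFreeL2 (Fin 3))
    (hvs : ∀ k', ¬ ((∀ i, (n:ℤ) ∣ k' i - ℓ i) ∨ (∀ i, (n:ℤ) ∣ k' i + ℓ i)) → fc v k' = 0)
    (hv1 : fc v ℓ = 0) (hv2 : fc v (-ℓ) = 0) :
    ‖fc (U s t v) ℓ‖
      ≤ (C₁ * (C₁ * (ν ^ e + ((⌈K / ν⌉₊ : ℝ) / n) ^ e) + (min 1 ((M * W.period / ν) / (t - s))) ^ e))
        * Real.sqrt (dW lo Λ c ν n (t - s) ℓ) * ‖v‖ := by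
  -- ### scalars
  have hn1r : (1:ℝ) ≤ n := by
    have h1 : (1:ℝ) ≤ ⌈K / ν⌉₊ := by
      have : 0 < K / ν := div_pos hK hν.1
      exact_mod_cast Nat.one_le_iff_ne_zero.2 (Nat.pos_iff_ne_zero.1 (Nat.ceil_pos.2 this))
    exact h1.trans hn
  have hn1 : 1 ≤ n := by exact_mod_cast hn1r
  have hn0 : (0:ℝ) < n := by linarith
  have hν0 : 0 < ν := hν.1
  have hν1 : ν ≤ 1 := hν.2.le.trans hν₀
  have hΛ1 : 1 ≤ Λ := hΛ.le
  have hΛ0 : 0 < Λ := by linarith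
  have hhi0 : 0 ≤ hi := by linarith
  have hloΛ : 0 < lo / Λ := div_pos hlo hΛ0
  have hWp := Summit.AnomalousDissipation.AnomalousDissipation.Theorems.SolenoidalFractalHomogenisation.PermissibleCarrier.period_pos W
  have hMW : 0 < M * W.period := mul_pos hM hWp
  set P : ℝ := M * W.period / ν with hPdef
  have hP0 : 0 < P := div_pos hMW hν0
  have hτ0 : 0 < t - s := sub_pos.2 hst
  have hs : 0 ≤ s := by rw [hsj]; positivity
  have hPτ0 : 0 ≤ (M * W.period / ν) / (t - s) := div_nonneg hP0.le hτ0.le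
  have hloT : 0 ≤ loT lo Λ c ν n := by
    unfold loT; have : 0 ≤ ν + c / ν := by positivity
    positivity
  have hC₁0 : 0 ≤ C₁ := by linarith
  have hℓ0 : ℓ ≠ 0 := Finset.ne_of_mem_erase hℓ
  have hℓB : ℓ ∈ Torus.freqBall (d := Fin 3) (n / 4) := Finset.mem_of_mem_erase hℓ
  have hLb : 2 * (n / 4) < n := by omega
  have hvcl : ∀ k', fc v k' ≠ 0 → (∀ i, (n : ℤ) ∣ k' i - ℓ i) ∨ (∀ i, (n : ℤ) ∣ k' i + ℓ i) :=
    fun k' hk' => by by_contra h; exact hk' (hvs k' h)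
  have hq := Torus.freqNormSq_nonneg ℓ
  set L : ℝ := ‖Torus.latticeVec ℓ‖ with hLdef
  have hL0 : 0 < L := by
    rw [hLdef]; refine norm_pos_iff.2 fun h => hℓ0 ?_
    funext i
    have hi := congrArg (fun w : EuclideanSpace ℝ (Fin 3) => w i) h
    simpa [Torus.latticeVec_apply] using hi
  have hLq : L ^ 2 = Torus.freqNormSq ℓ := by rw [hLdef, Torus.norm_latticeVec_sq]
  set θL : ℝ := 8 * Real.pi ^ 2 * (lo / Λ) * (M * W.period) * c * g₀ ^ 2 / (K + 1) ^ 2 with hθLdef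
  have hθL0 : 0 < θL := by rw [hθLdef]; positivity
  -- the allowance dominates its floor term `C₁²ν^e` and its window term `C₁·(min 1 (P/τ))^e`
  have hνe0 : 0 ≤ ν ^ e := Real.rpow_nonneg hν0.le e
  have hue0 : 0 ≤ ((⌈K / ν⌉₊ : ℝ) / n) ^ e := Real.rpow_nonneg (by positivity) e
  have hme0 : 0 ≤ (min 1 ((M * W.period / ν) / (t - s))) ^ e := Real.rpow_nonneg (le_min zero_le_one hPτ0) e
  -- the mid-row threshold follows from `hC₁b`
  have hC₁c : 2 * (12 * k * Real.exp (9 * (k : ℝ) ^ 2 / (2 * Real.pi ^ 4 * (lo / Λ) ^ 2 * c))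
      / (Real.pi ^ 2 * (lo / Λ) * Real.sqrt (8 * Real.pi ^ 2 * (lo / Λ) * (M * W.period) * c))) ≤ C₁ := by
    have hX : 0 ≤ 2 * Real.sqrt 2 * C ^ 2 * ((K + 1) ^ 2 / (8 * Real.pi ^ 2 * (lo / Λ) * (M * W.period) * c)) ^ (σ / 2) :=
      mul_nonneg (by positivity) (Real.rpow_nonneg (by positivity) _)
    have hY : 0 ≤ 2 * Real.sqrt 2 * C * (hi * Λ ^ 2 / lo) := by positivity
    have hZ : 0 ≤ 12 * k * Real.exp (9 * (k : ℝ) ^ 2 / (2 * Real.pi ^ 4 * (lo / Λ) ^ 2 * c))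
        / (Real.pi ^ 2 * (lo / Λ) * Real.sqrt (8 * Real.pi ^ 2 * (lo / Λ) * (M * W.period) * c)) := by positivity
    linarith
  by_cases hco : L * (⌈K / ν⌉₊ : ℝ) ≤ g₀ * n
  · -- ### COARSE label
    have hRP : 8 * Real.pi ^ 2 * loT lo Λ c ν n * Torus.freqNormSq ℓ * (M * W.period / ν) ≤ 1 :=
      coarse_RP_le_one W hC hc.le hlo hhi0 hΛ1 hM hν0 hν1 hK hn1 hg₀ hg₀1 hco hA
    by_cases hRτ : 8 * Real.pi ^ 2 * loT lo Λ c ν n * Torus.freqNormSq ℓ * (t - s) ≤ 2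
    · -- leaf 1: the intermediate row (carrier phase 0 at the grid start)
      have hphase : ∀ τ, cellField W M hM ν hν.1 n (s + τ) = cellField W M hM ν hν.1 n τ := fun τ => by
        rw [hsj]; exact VmodGen.cellField_add_nat_mul_period W M hM ν hν.1 n j τ
      exact VmodGen.leak_le_alw_of_scale_mid_fast hlo hhi0 hΛ1 hc hν hn1 hwin hU hs hst htT hphase hLb hℓ0 hℓB v hv hvcl hv1 hv2
        hC₁c he12 hRP hτP hRτ
    · have hRτ' : 2 ≤ 8 * Real.pi ^ 2 * loT lo Λ c ν n * Torus.freqNormSq ℓ * (t - s) := le_of_lt (not_le.1 hRτ)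
      by_cases hνg : ν ≤ g₀
      · -- leaf 2: the grid-iteration row ((V) consumed; smallness from `coarse_smallness` with `ν_c := g₀`)
        obtain ⟨hRP', hρ⟩ := VmodGen.coarse_smallness W hC hσ hc hlo hhi0 hΛ1 hM hν0 hν1 hK hn1 hℓ0 hg₀ hg₀1 hνg hco hgσ hgσ hA hB hBs hgd
        have hscale : L * (⌈K / ν⌉₊ : ℝ) ≤ n := hco.trans (by nlinarith)
        have hC₁a' : 2 * 265 * (2 * Real.sqrt 2) * C ^ 2 ≤ C₁ * C₁ := hC₁a.trans (by nlinarith)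
        have h := VmodGen.leak_le_alw_of_scale_iter_fast hV hlo hhi0 hΛ1 hc hC hσ hK.le hν hν1 hn1 hodd hwin hΦw hU hT j hsj hst htT
          hLb hℓ0 hℓB hscale v hv hvcl hv1 hv2 hC₁0 hC₁a' hC₁b heσ he12 hρ hRP' hRτ'
        refine h.trans (mul_le_mul_of_nonneg_right (mul_le_mul_of_nonneg_left
          (dW_le_sqrt_dW lo Λ c ν n (t - s) ℓ hloT hτ0.le) (by positivity)) (norm_nonneg _))
      · -- leaf 3: the floor row with `ν₁ := g₀`, `d₀ := 1/2`
        have hd : (1:ℝ) / 2 ≤ dW lo Λ c ν n (t - s) ℓ := by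
          unfold dW; exact half_le_one_sub_exp_neg_of_one_le (by linarith)
        have hfloor : 1 ≤ C₁ * C₁ * g₀ ^ e * Real.sqrt (1 / 2) := by
          have hge : 0 < g₀ ^ e * Real.sqrt (1 / 2) := mul_pos (Real.rpow_pos_of_pos hg₀ e) (Real.sqrt_pos.2 (by norm_num))
          have h1 : 1 ≤ C₁ * (g₀ ^ e * Real.sqrt (1 / 2)) := by
            have := mul_le_mul_of_nonneg_right hC₁f hge.le
            rwa [one_div_mul_cancel hge.ne'] at this
          have h2 : C₁ * (g₀ ^ e * Real.sqrt (1 / 2)) ≤ C₁ * C₁ * (g₀ ^ e * Real.sqrt (1 / 2)) := by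
            have : C₁ ≤ C₁ * C₁ := by nlinarith
            exact mul_le_mul_of_nonneg_right this hge.le
          linarith [h2]
        exact leak_le_alw_of_floor_fast (U s t) (hU.norm_le s t) hg₀ (le_of_lt (not_le.1 hνg)) he0 hC₁0 hPτ0 hd hfloor v
  · -- ### HIGH label
    have hhigh : g₀ * n < ‖Torus.latticeVec ℓ‖ * (⌈K / ν⌉₊ : ℝ) := by rw [← hLdef]; exact not_le.1 hco
    obtain ⟨hKL, hθ⟩ := VmodGen.high_label_bounds hloΛ.le hc.le hMW.le hν0 hν1 hK.le hn1 hg₀ hhigh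
    have hθ' : θL ≤ 8 * Real.pi ^ 2 * loT lo Λ c ν n * L ^ 2 * (M * W.period / ν) := by rw [hLq, hθLdef]; exact hθ
    have hℓn : 2 * ‖Torus.latticeVec ℓ‖ < n := two_norm_latticeVec_lt hn1 hℓB
    by_cases hνν : ν < νh
    · -- leaf 4: the W7 row (any phase)
      exact leak_le_alw_of_high_fast W M hM hc.le hH hlo hhi0 hΛ1 hCK hcK ⟨hν0, hνν⟩ hn1 hodd hwin hU hs htT hτP hL0 hKL hθL0 hθ'
        le_rfl hℓn v hvs (by linarith) hC₁h
    · -- leaf 5: the floor row with `ν₁ := νh`, `d₀ := ½·min 1 θL`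
      have hRτ : θL ≤ 8 * Real.pi ^ 2 * loT lo Λ c ν n * Torus.freqNormSq ℓ * (t - s) := by
        refine hθ.trans ?_
        exact mul_le_mul_of_nonneg_left hτP (by positivity)
      have hd : (1 / 2) * min 1 θL ≤ dW lo Λ c ν n (t - s) ℓ := by
        have h := VmodGen.one_sub_exp_neg_ge (le_trans hθL0.le hRτ)
        have hm : min 1 θL ≤ min 1 (8 * Real.pi ^ 2 * loT lo Λ c ν n * Torus.freqNormSq ℓ * (t - s)) := min_le_min le_rfl hRτ
        unfold dW; linarith
      have hfloor : 1 ≤ C₁ * C₁ * νh ^ e * Real.sqrt ((1 / 2) * min 1 θL) := by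
        have hm0 : 0 < (1 / 2) * min 1 θL := by have : 0 < min 1 θL := lt_min one_pos hθL0; positivity
        have hge : 0 < νh ^ e * Real.sqrt ((1 / 2) * min 1 θL) := mul_pos (Real.rpow_pos_of_pos hνh e) (Real.sqrt_pos.2 hm0)
        have h1 : 1 ≤ C₁ * (νh ^ e * Real.sqrt ((1 / 2) * min 1 θL)) := by
          have := mul_le_mul_of_nonneg_right hC₁g hge.le
          rwa [one_div_mul_cancel hge.ne'] at this
        have h2 : C₁ * (νh ^ e * Real.sqrt ((1 / 2) * min 1 θL)) ≤ C₁ * C₁ * (νh ^ e * Real.sqrt ((1 / 2) * min 1 θL)) := by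
          have : C₁ ≤ C₁ * C₁ := by nlinarith
          exact mul_le_mul_of_nonneg_right this hge.le
        linarith [h2]
      exact leak_le_alw_of_floor_fast (U s t) (hU.norm_le s t) hνh (not_lt.1 hνν) he0 hC₁0 hPτ0 hd hfloor v

end Summit.AnomalousDissipation.AnomalousDissipation.Theorems.SolenoidalFractalHomogenisation.LagrangianStep.VmodFlat

end
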